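import Mathlib.LinearAlgebra.Matrix.ToLinearEquiv
import Mathlib.Analysis.Complex.Basic
import Mathlib.Analysis.SpecialFunctions.Exp

/-!
# T⁴ programme, NE2 (U1a) sub-row Δ3 — EXPONENTIALLY WEIGHTED ROW SUMS: submultiplicativity, invertibility of a small
# perturbation, and the RESOLVENT BOUND `‖(D + tP)⁻¹‖_w ≤ W_G/(1 − |t|·W_G·W_P)` (generic finite index type)

NE2 formalisation swarm `b2b-balaban-t4-ne2-formalise-*`, leaf prover 05 (gen 5); file A of the supplier item «NE2-Δ3-SMALL-COUPLING»
(INTENT CLAIMS.log 2026-08-20).  Elementary finite-dimensional analysis, [folklore], no tree object involved: for a finite index type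
`ι`, a «distance» `ρ : ι → ι → ℝ` with the triangle inequality and a rate `δ ≥ 0`, the weighted row sums
`Σ_j e^{δ·ρ(i,j)}·‖A i j‖` of complex matrices are SUBMULTIPLICATIVE (`wrow_mul_le`); a matrix `D + t·P` with `D` invertible and
`‖t‖·Σ_j ‖(D⁻¹P)(i,j)‖ ≤ θ < 1` on every row is invertible (`isUnit_det_add_smul`: its kernel is trivial by sup-norm contraction);
and (**`wrow_inv_add_smul_le`**) if the weighted row sums of `D⁻¹` are `≤ WG`, those of `P` are `≤ π` and `‖t‖·WG·π < 1`, then EVERY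
weighted row sum of `(D + tP)⁻¹` is `≤ WG / (1 − ‖t‖·WG·π)` — the resolvent identity `X = D⁻¹ − t·D⁻¹·P·X` read at the maximal row
(no Neumann series); v1.1 §2 the RELATIVE forms `isUnit_det_add_smul_of_rel` / **`wrow_inv_add_smul_le_of_rel`** with the
hypothesis on `P·D⁻¹` (the weighted analogue of tier B's (H-bd) `‖P·𝒢‖ ≤ κ`; bound `WG/(1 − ‖t‖κ)`, row by row).  Consumer: `Support/SmallCouplingEntryDecay` (file B: the `hdec` of sub-row Δ3 at small coupling for
weighted-row-sum-bounded MODEL perturbations).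

HONEST FRAMING (T4-DAG p. 1).  Generic lemmas; nothing of Bałaban's carriers, nothing printed; NE2 (U1a) NOT proved; spine PROVED 0/9;
NOT infinite volume, NOT a mass gap, NOT Clay.  HONEST DEPENDENCY: continuum YM on T⁴ ⇐ BetaPertH ∧ nine spine estimates (0/9 proved); BetaPertH ⇐ (D1) ∧
(D4) ∧ CAP+tail; G-an2-4 gates asym, D1 and NE2/3/4.  No definition; no `sorry`.
-/

noncomputable section

open scoped BigOperators ComplexConjugate Matrix
open Finset

namespace Summit.QuantumFields.BalabanUV.T4Continuum.WeightedRowSumResolvent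

/-! ## §1 Weighted row sums -/

variable {ι : Type*} [Fintype ι] [DecidableEq ι]

omit [DecidableEq ι] in
/-- weighted row sums are nonnegative. [folklore] -/
theorem wrow_nonneg (ρ : ι → ι → ℝ) (δ : ℝ) (A : Matrix ι ι ℂ) (i : ι) :
    0 ≤ ∑ j, Real.exp (δ * ρ i j) * ‖A i j‖ :=
  Finset.sum_nonneg fun _ _ => mul_nonneg (Real.exp_pos _).le (norm_nonneg _)

omit [DecidableEq ι] in
/-- **SUBMULTIPLICATIVITY**: under the triangle inequality for `ρ` and `δ ≥ 0`, the weighted row sums of a product are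
bounded by (row bound of `A`) × (uniform row bound of `B`). [folklore] -/
theorem wrow_mul_le {ρ : ι → ι → ℝ} (htri : ∀ i j m, ρ i m ≤ ρ i j + ρ j m) {δ : ℝ} (hδ : 0 ≤ δ)
    (A B : Matrix ι ι ℂ) {WB : ℝ} (hB : ∀ j, ∑ m, Real.exp (δ * ρ j m) * ‖B j m‖ ≤ WB) (i : ι) :
    ∑ m, Real.exp (δ * ρ i m) * ‖(A * B) i m‖ ≤ (∑ j, Real.exp (δ * ρ i j) * ‖A i j‖) * WB := by
  calc ∑ m, Real.exp (δ * ρ i m) * ‖(A * B) i m‖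
      ≤ ∑ m, ∑ j, Real.exp (δ * ρ i j) * ‖A i j‖ * (Real.exp (δ * ρ j m) * ‖B j m‖) := by
        refine Finset.sum_le_sum fun m _ => ?_
        rw [Matrix.mul_apply]
        calc Real.exp (δ * ρ i m) * ‖∑ j, A i j * B j m‖
            ≤ Real.exp (δ * ρ i m) * ∑ j, ‖A i j‖ * ‖B j m‖ := by
              refine mul_le_mul_of_nonneg_left ((norm_sum_le _ _).trans (Finset.sum_le_sum fun j _ => ?_))
                (Real.exp_pos _).le
              exact (norm_mul_le _ _)
          _ = ∑ j, Real.exp (δ * ρ i m) * (‖A i j‖ * ‖B j m‖) := by rw [Finset.mul_sum]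
          _ ≤ ∑ j, Real.exp (δ * ρ i j) * ‖A i j‖ * (Real.exp (δ * ρ j m) * ‖B j m‖) := by
              refine Finset.sum_le_sum fun j _ => ?_
              have hw : Real.exp (δ * ρ i m) ≤ Real.exp (δ * ρ i j) * Real.exp (δ * ρ j m) := by
                rw [← Real.exp_add]
                exact Real.exp_le_exp.mpr (by nlinarith [htri i j m])
              calc Real.exp (δ * ρ i m) * (‖A i j‖ * ‖B j m‖)
                  ≤ (Real.exp (δ * ρ i j) * Real.exp (δ * ρ j m)) * (‖A i j‖ * ‖B j m‖) :=
                    mul_le_mul_of_nonneg_right hw (mul_nonneg (norm_nonneg _) (norm_nonneg _))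
                _ = Real.exp (δ * ρ i j) * ‖A i j‖ * (Real.exp (δ * ρ j m) * ‖B j m‖) := by ring
    _ = ∑ j, Real.exp (δ * ρ i j) * ‖A i j‖ * ∑ m, Real.exp (δ * ρ j m) * ‖B j m‖ := by
        rw [Finset.sum_comm]
        refine Finset.sum_congr rfl fun j _ => ?_
        rw [Finset.mul_sum]
    _ ≤ ∑ j, Real.exp (δ * ρ i j) * ‖A i j‖ * WB :=
        Finset.sum_le_sum fun j _ => mul_le_mul_of_nonneg_left (hB j) (mul_nonneg (Real.exp_pos _).le (norm_nonneg _))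
    _ = (∑ j, Real.exp (δ * ρ i j) * ‖A i j‖) * WB := by rw [Finset.sum_mul]

omit [DecidableEq ι] in
/-- a uniformly row-bounded matrix has the weighted `sup`-contraction property on vectors:
`|(A v) i| ≤ (Σ_j ‖A i j‖)·max|v|` (weights dropped: `e^{δρ} ≥ 1` is not needed here). [folklore] -/
theorem norm_mulVec_le (A : Matrix ι ι ℂ) (v : ι → ℂ) {c : ℝ} (hv : ∀ j, ‖v j‖ ≤ c) (i : ι) :
    ‖(A *ᵥ v) i‖ ≤ (∑ j, ‖A i j‖) * c := by
  rw [Matrix.mulVec, dotProduct, Finset.sum_mul]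
  refine (norm_sum_le _ _).trans (Finset.sum_le_sum fun j _ => ?_)
  rw [norm_mul]
  exact mul_le_mul_of_nonneg_left (hv j) (norm_nonneg _)

/-- **INVERTIBILITY FROM A SMALL PERTURBATION IN ROW-SUM NORM**: if `D` is invertible with inverse `G` and
`‖t‖·(Σ_j ‖(G·P) i j‖) < 1` for every row, then `D + t·P` is invertible (its kernel is trivial: `v = −t·G·P·v` contracts the
sup norm). [folklore] -/
theorem isUnit_det_add_smul {D P : Matrix ι ι ℂ} (hD : IsUnit D.det) {t : ℂ} {θ : ℝ} (hθ : θ < 1)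
    (hGP : ∀ i, ‖t‖ * ∑ j, ‖(D⁻¹ * P) i j‖ ≤ θ) : IsUnit (D + t • P).det := by
  classical
  rw [isUnit_iff_ne_zero, Ne, ← Matrix.exists_mulVec_eq_zero_iff]
  rintro ⟨v, hv0, hv⟩
  -- `v = -t • (G P) v`
  have hG : D⁻¹ * D = 1 := Matrix.nonsing_inv_mul D hD
  have hvfix : v = -(t • ((D⁻¹ * P) *ᵥ v)) := by
    have h1 : D⁻¹ *ᵥ ((D + t • P) *ᵥ v) = 0 := by rw [hv, Matrix.mulVec_zero]
    rw [Matrix.add_mulVec, Matrix.mulVec_add, Matrix.mulVec_mulVec, hG, Matrix.one_mulVec, Matrix.smul_mulVec,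
      Matrix.mulVec_smul, Matrix.mulVec_mulVec] at h1
    exact eq_neg_of_add_eq_zero_left h1
  -- sup norm contraction
  obtain ⟨i₀, -, hi₀⟩ := Finset.exists_max_image Finset.univ (fun j => ‖v j‖) (Finset.univ_nonempty_iff.mpr ⟨Classical.choice
    (by by_contra h; rw [not_nonempty_iff] at h; exact hv0 (funext fun j => (IsEmpty.false j).elim))⟩)
  have hmax : ∀ j, ‖v j‖ ≤ ‖v i₀‖ := fun j => hi₀ j (Finset.mem_univ j)
  have hle : ‖v i₀‖ ≤ θ * ‖v i₀‖ := by
    calc ‖v i₀‖ = ‖t‖ * ‖((D⁻¹ * P) *ᵥ v) i₀‖ := by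
          conv_lhs => rw [hvfix]
          rw [Pi.neg_apply, norm_neg, Pi.smul_apply, norm_smul]
      _ ≤ ‖t‖ * ((∑ j, ‖(D⁻¹ * P) i₀ j‖) * ‖v i₀‖) :=
          mul_le_mul_of_nonneg_left (norm_mulVec_le _ v hmax i₀) (norm_nonneg _)
      _ = (‖t‖ * ∑ j, ‖(D⁻¹ * P) i₀ j‖) * ‖v i₀‖ := by ring
      _ ≤ θ * ‖v i₀‖ := mul_le_mul_of_nonneg_right (hGP i₀) (norm_nonneg _)
  have hpos : 0 < ‖v i₀‖ := by
    refine lt_of_not_ge fun h => hv0 (funext fun j => ?_)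
    exact norm_le_zero_iff.mp ((hmax j).trans h)
  nlinarith


omit [DecidableEq ι] in
/-- weights are `≥ 1` when `δ·ρ ≥ 0`: the plain row sum is below the weighted one. [folklore] -/
theorem row_le_wrow {ρ : ι → ι → ℝ} {δ : ℝ} (hρ : ∀ i j, 0 ≤ δ * ρ i j) (A : Matrix ι ι ℂ) (i : ι) :
    ∑ j, ‖A i j‖ ≤ ∑ j, Real.exp (δ * ρ i j) * ‖A i j‖ :=
  Finset.sum_le_sum fun j _ => le_mul_of_one_le_left (norm_nonneg _) (Real.one_le_exp (hρ i j))

/-- **THE RESOLVENT BOUND IN WEIGHTED ROW-SUM NORM**: `D` invertible with `G = D⁻¹`, weighted row sums of `G` at most `WG`,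
of `P` at most `π`, and `‖t‖·WG·π < 1`; then `D + tP` is invertible and EVERY weighted row sum of `(D + tP)⁻¹` is at most
`WG / (1 − ‖t‖·WG·π)` — from the resolvent identity `X = G − t·G·P·X` read at the maximal row. [folklore] -/
theorem wrow_inv_add_smul_le {ρ : ι → ι → ℝ} (htri : ∀ i j m, ρ i m ≤ ρ i j + ρ j m) (hρ0 : ∀ i j, 0 ≤ ρ i j)
    {δ : ℝ} (hδ : 0 ≤ δ) {D P : Matrix ι ι ℂ} (hD : IsUnit D.det) {WG π : ℝ}
    (hG : ∀ i, ∑ j, Real.exp (δ * ρ i j) * ‖D⁻¹ i j‖ ≤ WG) (hP : ∀ i, ∑ j, Real.exp (δ * ρ i j) * ‖P i j‖ ≤ π)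
    {t : ℂ} (ht : ‖t‖ * WG * π < 1) (i : ι) :
    IsUnit (D + t • P).det ∧
      ∑ j, Real.exp (δ * ρ i j) * ‖(D + t • P)⁻¹ i j‖ ≤ WG / (1 - ‖t‖ * WG * π) := by
  have hρδ : ∀ i j, 0 ≤ δ * ρ i j := fun i j => mul_nonneg hδ (hρ0 i j)
  have hWG : 0 ≤ WG := (wrow_nonneg ρ δ D⁻¹ i).trans (hG i)
  have hπ : 0 ≤ π := (wrow_nonneg ρ δ P i).trans (hP i)
  -- row sums of `G P`
  have hGP : ∀ i, ∑ j, Real.exp (δ * ρ i j) * ‖(D⁻¹ * P) i j‖ ≤ WG * π := fun i =>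
    (wrow_mul_le htri hδ D⁻¹ P hP i).trans (mul_le_mul_of_nonneg_right (hG i) hπ)
  have hunit : IsUnit (D + t • P).det := by
    refine isUnit_det_add_smul hD ht fun i => ?_
    calc ‖t‖ * ∑ j, ‖(D⁻¹ * P) i j‖ ≤ ‖t‖ * ∑ j, Real.exp (δ * ρ i j) * ‖(D⁻¹ * P) i j‖ :=
          mul_le_mul_of_nonneg_left (row_le_wrow hρδ _ i) (norm_nonneg _)
      _ ≤ ‖t‖ * (WG * π) := mul_le_mul_of_nonneg_left (hGP i) (norm_nonneg _)
      _ = ‖t‖ * WG * π := by ring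
  refine ⟨hunit, ?_⟩
  set X : Matrix ι ι ℂ := (D + t • P)⁻¹ with hX
  -- the resolvent identity `X = G - t • (G * P * X)`
  have hres : X = D⁻¹ - t • (D⁻¹ * P * X) := by
    have h1 : (D + t • P) * X = 1 := Matrix.mul_nonsing_inv _ hunit
    have h2 : D⁻¹ * ((D + t • P) * X) = D⁻¹ := by rw [h1, Matrix.mul_one]
    rw [Matrix.add_mul, Matrix.mul_add, ← Matrix.mul_assoc, Matrix.nonsing_inv_mul D hD, Matrix.one_mul,
      Matrix.smul_mul, Matrix.mul_smul, ← Matrix.mul_assoc] at h2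
    rw [eq_sub_iff_add_eq]; exact h2
  -- the maximal weighted row of `X`
  set f : ι → ℝ := fun i => ∑ j, Real.exp (δ * ρ i j) * ‖X i j‖ with hf
  obtain ⟨i₀, -, hi₀⟩ := Finset.exists_max_image Finset.univ f (Finset.univ_nonempty_iff.mpr ⟨i⟩)
  have hmax : ∀ j, f j ≤ f i₀ := fun j => hi₀ j (Finset.mem_univ j)
  have hstep : f i₀ ≤ WG + ‖t‖ * WG * π * f i₀ := by
    have hsplit : ∀ j, Real.exp (δ * ρ i₀ j) * ‖X i₀ j‖
        ≤ Real.exp (δ * ρ i₀ j) * ‖D⁻¹ i₀ j‖ + ‖t‖ * (Real.exp (δ * ρ i₀ j) * ‖(D⁻¹ * P * X) i₀ j‖) := by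
      intro j
      have e : X i₀ j = D⁻¹ i₀ j - t * (D⁻¹ * P * X) i₀ j := by
        conv_lhs => rw [hres]
        simp [Matrix.sub_apply, Matrix.smul_apply]
      rw [e]
      calc Real.exp (δ * ρ i₀ j) * ‖D⁻¹ i₀ j - t * (D⁻¹ * P * X) i₀ j‖
          ≤ Real.exp (δ * ρ i₀ j) * (‖D⁻¹ i₀ j‖ + ‖t‖ * ‖(D⁻¹ * P * X) i₀ j‖) := by
            refine mul_le_mul_of_nonneg_left ((norm_sub_le _ _).trans ?_) (Real.exp_pos _).le
            rw [norm_mul]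
        _ = _ := by ring
    calc f i₀ ≤ ∑ j, (Real.exp (δ * ρ i₀ j) * ‖D⁻¹ i₀ j‖ + ‖t‖ * (Real.exp (δ * ρ i₀ j) * ‖(D⁻¹ * P * X) i₀ j‖)) :=
          Finset.sum_le_sum fun j _ => hsplit j
      _ = (∑ j, Real.exp (δ * ρ i₀ j) * ‖D⁻¹ i₀ j‖) + ‖t‖ * ∑ j, Real.exp (δ * ρ i₀ j) * ‖(D⁻¹ * P * X) i₀ j‖ := by
          rw [Finset.sum_add_distrib, Finset.mul_sum]
      _ ≤ WG + ‖t‖ * ((WG * π) * f i₀) := by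
          refine add_le_add (hG i₀) (mul_le_mul_of_nonneg_left ?_ (norm_nonneg _))
          have h := wrow_mul_le htri hδ (D⁻¹ * P) X hmax i₀
          exact h.trans (mul_le_mul_of_nonneg_right (hGP i₀) ((wrow_nonneg ρ δ X i).trans (hmax i)))
      _ = WG + ‖t‖ * WG * π * f i₀ := by ring
  have hden : 0 < 1 - ‖t‖ * WG * π := by linarith
  have hfi₀ : f i₀ ≤ WG / (1 - ‖t‖ * WG * π) := by
    rw [le_div_iff₀ hden]; nlinarith
  exact (hmax i).trans hfi₀


/-! ## §2 (v1.1) The RELATIVE form: hypotheses on `P·D⁻¹` instead of `P` (the weighted analogue of tier B's (H-bd)) -/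

/-- **INVERTIBILITY FROM A RELATIVE BOUND**: `D` invertible and `‖t‖·Σ_j ‖(P·D⁻¹) i j‖ ≤ θ < 1` on every row ⟹ `D + tP` invertible
(`D + tP = (1 + t·P·D⁻¹)·D` and the first factor has trivial kernel). [folklore] -/
theorem isUnit_det_add_smul_of_rel {D P : Matrix ι ι ℂ} (hD : IsUnit D.det) {t : ℂ} {θ : ℝ} (hθ : θ < 1)
    (hPG : ∀ i, ‖t‖ * ∑ j, ‖(P * D⁻¹) i j‖ ≤ θ) : IsUnit (D + t • P).det := by
  have h1 : IsUnit ((1 : Matrix ι ι ℂ) + t • (P * D⁻¹)).det := by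
    refine isUnit_det_add_smul (D := 1) (P := P * D⁻¹) (by rw [Matrix.det_one]; exact isUnit_one) hθ fun i => ?_
    rw [show (1 : Matrix ι ι ℂ)⁻¹ = 1 from inv_one, Matrix.one_mul]; exact hPG i
  have e : D + t • P = ((1 : Matrix ι ι ℂ) + t • (P * D⁻¹)) * D := by
    rw [Matrix.add_mul, Matrix.one_mul, Matrix.smul_mul, Matrix.mul_assoc, Matrix.nonsing_inv_mul D hD, Matrix.mul_one]
  rw [e, Matrix.det_mul]
  exact h1.mul hD

/-- **THE RESOLVENT BOUND, RELATIVE FORM**: weighted row sums of `D⁻¹` at most `WG`, of `P·D⁻¹` at most `κ` (the weighted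
analogue of tier B's `‖P·𝒢‖ ≤ κ`), and `‖t‖·κ < 1`; then `D + tP` is invertible and EVERY weighted row sum of `(D + tP)⁻¹` is at most
`WG / (1 − ‖t‖·κ)` — from `X = D⁻¹ − t·X·(P·D⁻¹)`, row by row (no maximal-row argument needed). [folklore] -/
theorem wrow_inv_add_smul_le_of_rel {ρ : ι → ι → ℝ} (htri : ∀ i j m, ρ i m ≤ ρ i j + ρ j m) (hρ0 : ∀ i j, 0 ≤ ρ i j)
    {δ : ℝ} (hδ : 0 ≤ δ) {D P : Matrix ι ι ℂ} (hD : IsUnit D.det) {WG κ : ℝ}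
    (hG : ∀ i, ∑ j, Real.exp (δ * ρ i j) * ‖D⁻¹ i j‖ ≤ WG) (hPG : ∀ i, ∑ j, Real.exp (δ * ρ i j) * ‖(P * D⁻¹) i j‖ ≤ κ)
    {t : ℂ} (ht : ‖t‖ * κ < 1) (i : ι) :
    IsUnit (D + t • P).det ∧
      ∑ j, Real.exp (δ * ρ i j) * ‖(D + t • P)⁻¹ i j‖ ≤ WG / (1 - ‖t‖ * κ) := by
  have hρδ : ∀ i j, 0 ≤ δ * ρ i j := fun i j => mul_nonneg hδ (hρ0 i j)
  have hκ : 0 ≤ κ := (wrow_nonneg ρ δ (P * D⁻¹) i).trans (hPG i)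
  have hunit : IsUnit (D + t • P).det := by
    refine isUnit_det_add_smul_of_rel hD ht fun i => ?_
    exact mul_le_mul_of_nonneg_left ((row_le_wrow hρδ _ i).trans (hPG i)) (norm_nonneg _)
  refine ⟨hunit, ?_⟩
  set X : Matrix ι ι ℂ := (D + t • P)⁻¹ with hX
  -- `X = D⁻¹ - t • (X * (P * D⁻¹))`
  have hres : X = D⁻¹ - t • (X * (P * D⁻¹)) := by
    have h1 : X * (D + t • P) = 1 := Matrix.nonsing_inv_mul _ hunit
    have h2 : X * (D + t • P) * D⁻¹ = D⁻¹ := by rw [h1, Matrix.one_mul]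
    rw [Matrix.mul_add, Matrix.add_mul, Matrix.mul_assoc X D, Matrix.mul_nonsing_inv D hD, Matrix.mul_one, Matrix.mul_smul,
      Matrix.smul_mul, Matrix.mul_assoc] at h2
    rw [eq_sub_iff_add_eq]; exact h2
  set f : ℝ := ∑ j, Real.exp (δ * ρ i j) * ‖X i j‖ with hf
  have hstep : f ≤ WG + ‖t‖ * κ * f := by
    have hsplit : ∀ j, Real.exp (δ * ρ i j) * ‖X i j‖
        ≤ Real.exp (δ * ρ i j) * ‖D⁻¹ i j‖ + ‖t‖ * (Real.exp (δ * ρ i j) * ‖(X * (P * D⁻¹)) i j‖) := by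
      intro j
      have e : X i j = D⁻¹ i j - t * (X * (P * D⁻¹)) i j := by
        conv_lhs => rw [hres]
        simp [Matrix.sub_apply, Matrix.smul_apply]
      rw [e]
      calc Real.exp (δ * ρ i j) * ‖D⁻¹ i j - t * (X * (P * D⁻¹)) i j‖
          ≤ Real.exp (δ * ρ i j) * (‖D⁻¹ i j‖ + ‖t‖ * ‖(X * (P * D⁻¹)) i j‖) := by
            refine mul_le_mul_of_nonneg_left ((norm_sub_le _ _).trans ?_) (Real.exp_pos _).le
            rw [norm_mul]
        _ = _ := by ring
    calc f ≤ ∑ j, (Real.exp (δ * ρ i j) * ‖D⁻¹ i j‖ + ‖t‖ * (Real.exp (δ * ρ i j) * ‖(X * (P * D⁻¹)) i j‖)) :=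
          Finset.sum_le_sum fun j _ => hsplit j
      _ = (∑ j, Real.exp (δ * ρ i j) * ‖D⁻¹ i j‖) + ‖t‖ * ∑ j, Real.exp (δ * ρ i j) * ‖(X * (P * D⁻¹)) i j‖ := by
          rw [Finset.sum_add_distrib, Finset.mul_sum]
      _ ≤ WG + ‖t‖ * (f * κ) :=
          add_le_add (hG i) (mul_le_mul_of_nonneg_left (wrow_mul_le htri hδ X (P * D⁻¹) hPG i) (norm_nonneg _))
      _ = WG + ‖t‖ * κ * f := by ring
  have hden : 0 < 1 - ‖t‖ * κ := by linarith
  rw [le_div_iff₀ hden]; nlinarith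

end Summit.QuantumFields.BalabanUV.T4Continuum.WeightedRowSumResolvent

end
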